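import Literature.AlgebraicGeometry.ShimuraVarieties.UnitaryShimuraCanonicalModelPrinted
import Literature.AlgebraicGeometry.HodgeTheory.AlgebraicCyclesDefinedOverQbarSpread
import Literature.AlgebraicGeometry.Motives.ProjectiveDescentProofs
import HarnessLib

/-!
# [Deligne 1979, 2.2.5 + Cor. 2.7.21] for the compact unitary Shimura surface AS «A FORM OVER THE REFLEX FIELD WITH RECIPROCITY»:
# the `smooth` ∕ `projective` clauses of `canonicalModel_exists_printed` carry no assumption

Topic `AlgebraicGeometry/ShimuraVarieties`; namespace `Literature.AlgebraicGeometry.ShimuraVarieties`, grouping sub-namespace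
`UnitaryCanonicalModel`.  ONE definition with body (`canonicalModel_exists_form : Prop` — [Deligne1979ShimuraVarieties] 2.2.5 read
LITERALLY: «a form over `E(G,X)` of `M_ℂ(G,X)` … such that … (b) the Galois group acts through the action 2.2.4», i.e. the proposition
`canonicalModel_exists_printed` of `UnitaryShimuraCanonicalModelPrinted` WITHOUT its two clauses «`M_K` smooth of relative dimension `2`»
and «`M_K` projective over `L`»; D-0014: the SAME cite, NOT proved here, never asserted) and THEOREMS: the two clauses are CONSEQUENCES of
the form `e : M ⊗_{L,τ} ℂ ≅ M_ℂ` because `M_ℂ` (any complex record system) is smooth projective over `ℂ` and smoothness ∕ the relative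
dimension ∕ projectivity DESCEND along the field extension `τ : L → ℂ` — all three descents are THEOREMS OF THE TREE (fpqc descent of
smoothness, Mathlib `MorphismProperty.of_isPullback_of_descendsAlong`, [EGA IV₄ 17.7.4]; the relative dimension,
`HodgeTheory.smoothOfRelativeDimension_hom_of_baseChangeHom`, [Stacks 02G2 ∕ 0C0C]; projectivity,
`Motives.IsProjectiveOver.of_baseChange_holds`, [Görtz–Wedhorn I, Prop. 14.57]) — whence
`canonicalModel_exists_printed ↔ canonicalModel_exists_form` in the kernel.  No Summits import; nothing asserted; T5: n/a
(the two descent theorems have ONE structural hypothesis, the form `e`).  HC_CM is not mentioned and not implied.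

## References
* [Deligne1979ShimuraVarieties] P. Deligne, *Variétés de Shimura* (1979), 2.2.5 (PDF p. 29 L16–28 of Milne's translation
  `paper:url-7710442a1cf6`): «By "form" we mean a scheme `M` over `E(G,X)` equipped with … an equivariant isomorphism
  `M ⊗_{E(G,X)} ℂ ⥲ M_ℂ(G,X)`»; Cor. 2.7.21 (PDF pp. 51–52).
* [EGAIV4] A. Grothendieck, J. Dieudonné, *EGA IV₄* (1967), Prop. 17.7.4; [GrothendieckDieudonne1965] *EGA IV₂*, Prop. 2.7.1.
* [GortzWedhorn2020] U. Görtz, T. Wedhorn, *Algebraic Geometry I* (2nd ed. 2020), Prop. 14.57 (p. 571).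
* [StacksProject] Tags 02G2, 0C0C.
-/

set_option autoImplicit false

noncomputable section

open Function MulAction Topology NumberField IsDedekindDomain CategoryTheory CategoryTheory.Limits Matrix AlgebraicGeometry
open scoped Matrix ComplexOrder
open Literature.AlgebraicGeometry.Motives
open Literature.NumberTheory.Automorphic Literature.NumberTheory.Automorphic.UnitaryGroup
open Literature.NumberTheory.Automorphic.Liu2021.AppendixC (C5.OpenCompactSubgroup C5.SmallLevel)
open Literature.Geometry.ComplexHyperbolic Literature.Geometry.ComplexHyperbolic.BallModel
open Literature.NumberTheory.Automorphic.ShimuraDissection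

namespace Literature.AlgebraicGeometry.ShimuraVarieties

namespace UnitaryCanonicalModel

/-! ### §1. Descent of «smooth of relative dimension 2» and «projective» along the form `M ⊗_{L,τ} ℂ ≅ M_ℂ` -/

section Descent

/-- **Smoothness of the structure morphism descends along `τ : L → ℂ`**: if `X ⊗_{L,τ} ℂ → Spec ℂ` is smooth then so is
`X → Spec L` (fpqc descent along the surjective flat quasi-compact `Spec ℂ → Spec L`; Mathlib `Smooth.descendsAlong`).
[cite: EGAIV4, Prop. 17.7.4 (vi)⇒(i)] [cite: GrothendieckDieudonne1965, Prop. 2.7.1] -/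
theorem smooth_hom_of_baseChangeHom {L : Type} [Field L] (τ : L →+* ℂ) (X : SchemeOver L)
    [Smooth ((Motives.baseChangeHom τ).obj X).hom] : Smooth X.hom := by
  haveI : Subsingleton ↥(Spec (CommRingCat.of L)) := inferInstanceAs (Subsingleton (PrimeSpectrum L))
  haveI : AlgebraicGeometry.Surjective (Spec.map (CommRingCat.ofHom τ)) :=
    ⟨fun x ↦ ⟨(default : ↥(Spec (CommRingCat.of ℂ))), Subsingleton.elim _ _⟩⟩
  have hQ : (@AlgebraicGeometry.Surjective ⊓ @Flat ⊓ @QuasiCompact : MorphismProperty Scheme) (Spec.map (CommRingCat.ofHom τ)) :=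
    ⟨⟨‹_›, inferInstance⟩, inferInstance⟩
  exact MorphismProperty.of_isPullback_of_descendsAlong (P := @Smooth) (Q := @AlgebraicGeometry.Surjective ⊓ @Flat ⊓ @QuasiCompact)
    (IsPullback.of_hasPullback X.hom (Spec.map (CommRingCat.ofHom τ))).flip hQ
    (show Smooth (pullback.snd X.hom (Spec.map (CommRingCat.ofHom τ))) from ‹Smooth ((Motives.baseChangeHom τ).obj X).hom›)

variable {L : Type} [Field L] [NumberField L] [IsCMField L] {H : Matrix (Fin 3) (Fin 3) L} {τ : L →+* ℂ}
  {T : GL (Fin 3) ℂ} {hT : formCongr (starRingEnd ℂ) T (H.map τ) = BallModel.J}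
  {K₀ : C5.OpenCompactSubgroup ↥(finAdelic (↥(maximalRealSubfield L)) L (IsCMField.complexConj L) 3 H)}

/-- **The models of a form of a complex record system are smooth of relative dimension `2` over `L`**: for
`e : M ⊗_{L,τ} ℂ ≅ Sc.Mc`, each `(M_K)_τ` is isomorphic over `ℂ` to the smooth surface `Sc.Mc_K` (clause (C1) of the complex record
system), so `(M_K)_τ → Spec ℂ` is smooth of relative dimension `2` (the property respects isomorphisms), and smoothness with its relative
dimension descends to `M_K → Spec L` (`smooth_hom_of_baseChangeHom`, tree `HodgeTheory.smoothOfRelativeDimension_hom_of_baseChangeHom`).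
[cite: EGAIV4, Prop. 17.7.4] [cite: StacksProject, Tag 02G2 and Tag 0C0C] -/
theorem smoothOfRelativeDimension_of_form (Sc : ComplexRecordSystem L H τ T hT K₀) (M : C5.SmallLevel K₀ ⥤ SchemeOver L)
    (e : (M ⋙ Motives.baseChangeHom τ) ≅ Sc.Mc) (K : C5.SmallLevel K₀) :
    AlgebraicGeometry.SmoothOfRelativeDimension 2 (M.obj K).hom := by
  -- the component of the form at `K`, an isomorphism of `ℂ`-schemes `(M_K)_τ ≅ Sc.Mc_K`
  let eK : (Motives.baseChangeHom τ).obj (M.obj K) ≅ Sc.Mc.obj K := e.app K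
  haveI : IsIso eK.hom.left := (inferInstance : IsIso ((Over.forget _).mapIso eK).hom)
  haveI := Sc.smooth K
  -- `(M_K)_τ → Spec ℂ` = `eK ≫ (Sc.Mc_K → Spec ℂ)` is smooth of relative dimension `2`
  haveI hbc : AlgebraicGeometry.SmoothOfRelativeDimension 2 ((Motives.baseChangeHom τ).obj (M.obj K)).hom := by
    rw [← Over.w eK.hom]
    exact (MorphismProperty.cancel_left_of_respectsIso (@AlgebraicGeometry.SmoothOfRelativeDimension 2) _ _).mpr (Sc.smooth K)
  haveI : Smooth ((Motives.baseChangeHom τ).obj (M.obj K)).hom := AlgebraicGeometry.SmoothOfRelativeDimension.smooth 2 _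
  haveI : Smooth (M.obj K).hom := smooth_hom_of_baseChangeHom τ (M.obj K)
  exact Literature.AlgebraicGeometry.HodgeTheory.smoothOfRelativeDimension_hom_of_baseChangeHom τ (M.obj K)

/-- **The models of a form of a complex record system are projective over `L`**: each `(M_K)_τ ≅ Sc.Mc_K` is projective over `ℂ`
(clause (C1); projectivity is invariant under isomorphisms of `ℂ`-schemes), and projectivity descends along the field extension
`τ : L → ℂ` (tree `Motives.IsProjectiveOver.of_baseChange_holds` — Görtz–Wedhorn I Prop. 14.57, PROVED in the tree: spread to a finite
subextension, then norms of ample divisors). [cite: GortzWedhorn2020, Prop. 14.57 (p. 571)] -/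
theorem isProjectiveOver_of_form (Sc : ComplexRecordSystem L H τ T hT K₀) (M : C5.SmallLevel K₀ ⥤ SchemeOver L)
    (e : (M ⋙ Motives.baseChangeHom τ) ≅ Sc.Mc) (K : C5.SmallLevel K₀) : IsProjectiveOver (M.obj K) := by
  letI : Algebra L ℂ := τ.toAlgebra
  let eK : (Motives.baseChangeHom τ).obj (M.obj K) ≅ Sc.Mc.obj K := e.app K
  -- projectivity over `ℂ` transports along `eK`
  have hbc : IsProjectiveOver ((Motives.baseChangeHom τ).obj (M.obj K)) := by
    obtain ⟨n, κ, hκ⟩ := Sc.projective K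
    haveI := hκ
    exact ⟨n, eK.hom ≫ κ, inferInstanceAs (IsClosedImmersion (eK.hom.left ≫ κ.left))⟩
  -- … and descends along `τ : L → ℂ`
  exact Motives.IsProjectiveOver.of_baseChange_holds (M.obj K) ℂ hbc

end Descent

/-! ### §2. [Deligne 1979, 2.2.5 + Cor. 2.7.21] as «a form over `τ(L)` with reciprocity» -/

/-- **[Deligne 1979, 2.2.5 + Cor. 2.7.21] for the compact unitary Shimura surface, read LITERALLY as «`M_ℂ(G,X)` admits a form over
`E(G,X) = τ(L)` on which the Galois group acts at the special points through 2.2.4»** (named proposition, D-0014; NO proof, never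
asserted; the SAME cite as `exists_recordSystem` ∕ `canonicalModel_exists_printed`, to both of which it is kernel-equivalent —
`canonicalModel_exists_printed_iff_form` below and the Summits-side `DelRec` rows): at every datum of `exists_recordSystem` (binders
VERBATIM) and for EVERY complex record system `Sc` below `K₀` ([Deligne1979ShimuraVarieties] 2.1.2–2.1.4, the complex Shimura surfaces
`_K M_ℂ(G,X)`, `K ≤ K₀`, algebraised), there are `L`-schemes `M_K`, functorial in `K ≤ K₀` (2.1.4), an isomorphism of functors
`e : M ⊗_{L,τ} ℂ ≅ Sc.Mc` — «By "form" we mean a scheme `M` over `E(G,X)` equipped with … an equivariant isomorphism `M ⊗_{E(G,X)} ℂ ⥲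
M_ℂ(G,X)`» — and the reciprocity law (62) at the diagonal special pairs (`IsCanonicalDescentAt Sc M e`, clause (b) of 2.2.5 as in
[Milne2005ShimuraVarieties] Def. 12.8 ∕ Rem. 12.9).  NO smoothness ∕ projectivity clause: those are theorems (§1).  Weaker than the print
exactly as `canonicalModel_exists_printed` is (levels below one `K₀`, inclusions only, diagonal pairs only, no uniqueness).
[cite: Deligne1979ShimuraVarieties, 2.2.5 and Cor. 2.7.21 (PDF pp. 29, 51–52 of Milne's translation); 2.1.2–2.1.4]
[cite: Milne2005ShimuraVarieties, Def. 12.8 (62) p. 114; Rem. 12.9 and Def. 12.10 p. 115] -/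
def canonicalModel_exists_form : Prop :=
  ∀ (L : Type) [Field L] [NumberField L] [IsCMField L] (H : Matrix (Fin 3) (Fin 3) L) (τ : L →+* ℂ)
    (T : GL (Fin 3) ℂ) (hT : formCongr (starRingEnd ℂ) T (H.map τ) = BallModel.J),
    (∀ τ' : L →+* ℂ, InfinitePlace.mk τ' ≠ InfinitePlace.mk τ → (H.map τ').PosDef) →
    (∀ v : Fin 3 → L, hermForm (cmConjRingHom L) H v v = 0 → v = 0) →
    ∀ K₀ : C5.OpenCompactSubgroup ↥(finAdelic (↥(maximalRealSubfield L)) L (IsCMField.complexConj L) 3 H),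
      (∀ g : finAdelic (↥(maximalRealSubfield L)) L (IsCMField.complexConj L) 3 H,
        ∀ γ ∈ arithmeticLevel (↥(maximalRealSubfield L)) L (IsCMField.complexConj L) 3 H
          (K₀.1.map (MulAut.conj g).toMonoidHom), IsOfFinOrder γ → γ = 1) →
        ∀ Sc : ComplexRecordSystem L H τ T hT K₀,
          ∃ (M : C5.SmallLevel K₀ ⥤ SchemeOver L) (e : (M ⋙ Motives.baseChangeHom τ) ≅ Sc.Mc), IsCanonicalDescentAt Sc M e

/-- **The printed-shape statement with and without its `smooth` ∕ `projective` clauses are EQUIVALENT** (kernel): `→` forgets the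
two clauses; `←` recovers them from the form by descent along `τ : L → ℂ` (`smoothOfRelativeDimension_of_form`,
`isProjectiveOver_of_form`).  So displaying `canonicalModel_exists_form` — [Deligne1979ShimuraVarieties] 2.2.5 + Cor. 2.7.21 read as
«form over the reflex field + reciprocity (b)» and nothing else — is a kernel-equivalent display of `canonicalModel_exists_printed`
(hence, by the Summits-side `DelRec` rows, of `exists_recordSystem`).
[cite: Deligne1979ShimuraVarieties, 2.2.5 and Cor. 2.7.21 (PDF pp. 29, 51–52 of Milne's translation)]
[cite: GortzWedhorn2020, Prop. 14.57 (p. 571)] [cite: EGAIV4, Prop. 17.7.4] -/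
theorem canonicalModel_exists_printed_iff_form : canonicalModel_exists_printed ↔ canonicalModel_exists_form := by
  constructor
  · intro h L _ _ _ H τ T hT hpos hanis K₀ htf Sc
    obtain ⟨M, -, -, e, hrec⟩ := h L H τ T hT hpos hanis K₀ htf Sc
    exact ⟨M, e, hrec⟩
  · intro h L _ _ _ H τ T hT hpos hanis K₀ htf Sc
    obtain ⟨M, e, hrec⟩ := h L H τ T hT hpos hanis K₀ htf Sc
    exact ⟨M, fun K => smoothOfRelativeDimension_of_form Sc M e K, fun K => isProjectiveOver_of_form Sc M e K, e, hrec⟩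

end UnitaryCanonicalModel

end Literature.AlgebraicGeometry.ShimuraVarieties

end
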